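/-
Copyright: literature formalisation for the harness. Statements follow the cited text.
-/
import Mathlib
import HarnessLib

/-!
# Cossart–Piltant I (2008), Proposition 8.3 (2) — the exponent bookkeeping (35)–(43) (HAL pp. 24–26)

V. Cossart, O. Piltant, *Resolution of singularities of threefolds in positive characteristic I*,
J. Algebra 320 (2008) 1051–1082 [CossartPiltant2008]; manuscript hal-00139124 ("HAL"), there
Proposition 8.3 (journal Proposition 6.3): pull-up of local uniformization along an extension
`L = K(η)` of PRIME degree `l` (any prime, including `l = p`) under assumption (2)
`[L : K] = |Γ_W / Γ_V|`. The tree carries the statement as the named fact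
`CP2008.PrimeDegreeAscent` (`Ramification2008.lean`); this file does NOT discharge it. It
kernel-checks the ARITHMETIC SKELETON of the proof, HAL printed pp. 24–26, equations
(35)–(43), which the pub-hironaka reading notes (GAPS §GA rows G-A18, G7-A18.1) had certified by
reading only ("the gcd/lattice bookkeeping (41)–(43) … read, not re-derived symbol by symbol").
Locators "p. N l. M" below mean: printed page N of the HAL manuscript, line M of the harness text
extraction of that page (`lit read paper:doi-10-1016-j-jalgebra-2008-03-032`, file `p00(N+1).txt`).

## Dictionary (text ↦ this file)

After (36)–(37) every quantity in play is a monomial in the regular parameters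
`x_0^{(j)}, …, x_r^{(j)}` of `S^{(j)}` times a unit, and the proof only ever uses EXPONENT VECTORS
indexed by `{0,…,r}`; here the index set is an arbitrary finite type `ι` (the argument is
dimension-free — `r + 1 ≤ 4` plays no role), exponent vectors are `ι → ℤ`.

* `X := exp(x_0^l)`, `B := exp(f_l)` and the DIFFERENCE VECTOR `d := X − B`. Then
  `g^{(j)} = gcd(x_0^l, f_l)` has exponent `min(X, B)`, `x_0^l / g^{(j)}` has exponent `d⁺`
  (positive part), `f_l / g^{(j)}` has exponent `d⁻`, so `E^{(j)} = {d > 0}`, `F^{(j)} = {d < 0}`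
  (disjoint, as the text notes) and `ε^{(j)} = |d|` (`PrimeAscent83.eps`), extended by `0` off
  `E ∪ F` exactly as in the text.
* One step `S^{(j−1)} < S^{(j)}` of Lemma 8.2 (monoidal transform at `(x_{i_j}, x_{i'_j})`,
  chart `x_{i'_j}^{(j−1)} = x_{i_j}^{(j)} x_{i'_j}^{(j)}`, `x_i^{(j−1)} = x_i^{(j)}` for `i ≠ i'_j`,
  Lemma 8.2 (1)(2)) acts on exponent vectors by `PrimeAscent83.move i_j i'_j`:
  `c ↦ c + c_{i'_j} · e_{i_j}`; it is additive, so `d` transforms by the same move.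
* `δ^{(j)} := gcd({ε_i^{(j)}}_{i ∈ E^{(j)} ∪ F^{(j)}})` is `PrimeAscent83.delta d` (literally: the
  `Finset.gcd` of `|d|` over the support of `d`).
* At `j = 0`: `X = l · e_0`, `B = Σ_{i ≥ 1} α_i e_i`, so `d^{(0)} = (l, −α_1, …, −α_r)`.
* At `j = n − 1`: `X = l · (row 0 of A)`, `B = Σ_i α_i (row i of A)`, i.e.
  `d^{(n−1)} = d^{(0)} ᵥ* A` with `A ∈ GL(r+1, ℤ)` the matrix of (37).

## What is proved (all `sorry`-free; tags `[cite: CossartPiltant2008, Prop 8.3]` = "this is the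
## content of the cited lines", the Lean proofs are ours)

* (41)–(43) `eps_move_of_ne`, `eps_move_same_sign`, `eps_move_opposite_sign` — the
  transformation laws, with the side condition of (42) read at stage `j − 1`
  (`0 ≤ d_{i_j} · d_{i'_j}`); `eps_move_printed_condition_counterexample` records that with the
  side condition read at stage `j` (as printed in HAL: "`{i_j, i'_j} ⊆ E^{(j)}` or `⊆ F^{(j)}`")
  law (42) fails for `d = (−1, 3)` — a misprint-level slip which is HARMLESS because the proof
  uses (41)–(43) only through the next item.
* `delta_move` : `δ^{(j)} = δ^{(j−1)}` (HAL p. 26 l. 5) for EVERY move with `i_j ≠ i'_j`,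
  whatever the signs; `delta_moves` for a whole Perron sequence; `gcd_vecMul_of_isUnit_det`: the
  same invariance in matrix form (`gcd (d ᵥ* A) = gcd d` for `A ∈ GL(ι, ℤ)`).
* `delta_init_eq_one_iff` : for `d^{(0)} = (l, −α)` with `l` prime, `δ^{(0)} = 1 ↔ ¬ ∀ i, l ∣ α_i`,
  and `not_forall_dvd_of_not_mem` : assumption (2) (`W η ∉ Γ_V`, `l · Wη = Σ α_i W x_i`,
  `W x_i ∈ Γ_V`, value group torsion-free) gives `¬ ∀ i, l ∣ α_i` — "By assumption (2) in the
  proposition, we have `δ^{(0)} = 1`" (HAL p. 25 l. 117).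
* (38)–(39) `coeff_eq_of_linearIndependent` : if `Σ_j d_j · w_j = 0`, `w_{i_n} = w_{i'_n}` and
  `{w_j}_{j ≠ i'_n}` is `ℤ`-linearly independent, then `d_j = 0` off `{i_n, i'_n}` and
  `d_{i_n} + d_{i'_n} = 0`.
* (40) `m_eq_abs`, `m_pos_of_ne_zero`, `vecMul_ne_zero_of_det_ne_zero`, `delta_eq_abs_of_pair`,
  `m_eq_one`, `m_eq_one_matrix` : with `m := d⁺_{i_n} + d⁺_{i'_n}` as in the text, `m = |d_{i_n}|`, `m > 0` "since
  `A` is a nonsingular matrix" (p. 25 l. 76), `δ^{(n−1)} = m`, hence `m = δ^{(n−1)} = δ^{(0)} = 1` —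
  the claim of HAL p. 25 l. 78 / p. 26 l. 5–6 (with the misprint `d(j) ↦ δ^{(j)}` of G7-A18.1).
* `min_le_middle`, `sum_lt_sum_of_pairing_ne` : the two inequalities behind (40)'s "`+` terms of
  order at least `m + 1`": every middle term `f_i x_0^{l−i}` (`1 ≤ i ≤ l − 1`) is divisible by
  `g` (componentwise `min(X,B) ≤ exp(f_i x_0^{l−i})`, from `I R = (f_l^{l!/l})`, i.e.
  `i · B ≤ l · exp(f_i)`), and has order `> ord g + m` (from the STRICT inequality (35) against
  positive weights).
* `instance_l2` : the whole bookkeeping evaluated by the kernel on the smallest instance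
  (`l = p = 2`, `r = 1`, `f_2 = u x_1^3`).

Cell record: pub-hironaka GAPS §GA row G10-A18.2 (CERT-K of (35)–(43)) and G10-A18.3 (the
side-condition slip). Nothing here is specific to dimension three. No statement of
[CossartPiltant2008] is contradicted by anything in this file.

## Sources

* V. Cossart, O. Piltant, J. Algebra 320 (2008), Prop. 6.3 = HAL hal-00139124 Prop. 8.3, proof,
  pp. 24–26, equations (35)–(43); Lemma 8.2 (Perron algorithm), p. 23. [CossartPiltant2008]
* O. Zariski, *Local uniformization on algebraic varieties*, Ann. Math. 41 (1940), Thm 1 p. 862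
  (the Perron algorithm behind Lemma 8.2). [Zariski1940]
-/

namespace Literature.AlgebraicGeometry.CossartPiltant200819.CP2008

namespace PrimeAscent83

open Finset

variable {ι : Type*} [DecidableEq ι]

/-! ### The Perron exponent move (Lemma 8.2 (1)(2)) -/

/-- The effect of one monoidal transform of Lemma 8.2 at `(x_i, x_{i'})` (chart
`x_{i'}^{old} = x_i^{new} x_{i'}^{new}`, `x_k^{old} = x_k^{new}` for `k ≠ i'`) on the exponent
vector `c` of a monomial: the new exponent of `x_i` is `c i + c i'`, all others are unchanged.
[cite: CossartPiltant2008, Lemma 8.2 (1)(2) and (41)–(43)] -/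
def move (i i' : ι) (c : ι → ℤ) : ι → ℤ :=
  Function.update c i (c i + c i')

omit [DecidableEq ι] in
/-- The exponent vector `ε` of the text: `ε_k = |d_k|` where `d = exp(x_0^l) − exp(f_l)`; it is
the exponent of `x_k` in `x_0^l / g` (if `d_k > 0`, `k ∈ E`) or in `f_l / g` (if `d_k < 0`,
`k ∈ F`), and `0` off `E ∪ F`. [cite: CossartPiltant2008, Prop 8.3, p. 25 l. 108–110] -/
def eps (d : ι → ℤ) : ι → ℤ := fun k => |d k|

/-- The new exponent of `x_i` is `c i + c i'` (Lemma 8.2 (1): `x_{i'}^{old} = x_i x_{i'}`).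
[folklore] -/
@[simp] theorem move_apply_self (i i' : ι) (c : ι → ℤ) : move i i' c i = c i + c i' := by
  simp [move]

/-- The exponents of `x_k`, `k ≠ i`, are unchanged (Lemma 8.2 (2)). [folklore] -/
@[simp] theorem move_apply_of_ne {i i' k : ι} (c : ι → ℤ) (hk : k ≠ i) :
    move i i' c k = c k := by
  simp [move, hk]

/-- The move is additive in the exponent vector (a product of monomials has the sum of the
exponents), hence acts on the difference vector `d = X − B` by the same formula. [folklore] -/
theorem move_sub (i i' : ι) (a b : ι → ℤ) : move i i' (a - b) = move i i' a - move i i' b := by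
  funext k
  by_cases hk : k = i
  · subst hk; simp [move]; ring
  · simp [move, hk]

/-- [folklore] -/
theorem move_add (i i' : ι) (a b : ι → ℤ) : move i i' (a + b) = move i i' a + move i i' b := by
  funext k
  by_cases hk : k = i
  · subst hk; simp [move]; ring
  · simp [move, hk]

/-- A move with `i ≠ i'` does not change the `i'`-coordinate. [folklore] -/
theorem move_apply_snd {i i' : ι} (c : ι → ℤ) (h : i ≠ i') : move i i' c i' = c i' :=
  move_apply_of_ne c (Ne.symm h)

/-! ### (41)–(43): the transformation laws for `ε = |d|` -/

/-- (41): `ε_k^{(j)} = ε_k^{(j−1)}` for `k ≠ i_j`. [cite: CossartPiltant2008, Prop 8.3 (41)] -/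
theorem eps_move_of_ne {i i' k : ι} (d : ι → ℤ) (hk : k ≠ i) :
    eps (move i i' d) k = eps d k := by
  simp [eps, move_apply_of_ne d hk]

/-- (42): `ε_{i_j}^{(j)} = ε_{i_j}^{(j−1)} + ε_{i'_j}^{(j−1)}` when `i_j, i'_j` lie on the same side
AT STAGE `j − 1` (both in `E^{(j−1)}` or both in `F^{(j−1)}`, i.e. `d_{i_j} d_{i'_j} ≥ 0`).
[cite: CossartPiltant2008, Prop 8.3 (42)] -/
theorem eps_move_same_sign {i i' : ι} (d : ι → ℤ) (h : 0 ≤ d i * d i') :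
    eps (move i i' d) i = eps d i + eps d i' := by
  simp only [eps, move_apply_self]
  rcases le_total 0 (d i) with hi | hi <;> rcases le_total 0 (d i') with hi' | hi'
  · rw [abs_of_nonneg hi, abs_of_nonneg hi', abs_of_nonneg (by linarith)]
  · rcases eq_or_lt_of_le hi with h0 | h0
    · rw [← h0]; simp
    · have : d i' = 0 := le_antisymm hi' (by nlinarith)
      rw [this]; simp
  · rcases eq_or_lt_of_le hi' with h0 | h0
    · rw [← h0]; simp
    · have : d i = 0 := le_antisymm hi (by nlinarith)
      rw [this]; simp
  · rw [abs_of_nonpos hi, abs_of_nonpos hi', abs_of_nonpos (by linarith)]; ring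

/-- (43): `ε_{i_j}^{(j)} = |ε_{i_j}^{(j−1)} − ε_{i'_j}^{(j−1)}|` otherwise (opposite sides at stage
`j − 1`, i.e. `d_{i_j} d_{i'_j} ≤ 0`). [cite: CossartPiltant2008, Prop 8.3 (43)] -/
theorem eps_move_opposite_sign {i i' : ι} (d : ι → ℤ) (h : d i * d i' ≤ 0) :
    eps (move i i' d) i = |eps d i - eps d i'| := by
  simp only [eps, move_apply_self]
  rcases le_total 0 (d i) with hi | hi <;> rcases le_total 0 (d i') with hi' | hi'
  · rcases eq_or_lt_of_le hi with h0 | h0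
    · rw [← h0]; simp
    · have : d i' = 0 := le_antisymm (by nlinarith) hi'
      rw [this]; simp
  · rw [abs_of_nonneg hi, abs_of_nonpos hi']; ring_nf
  · rw [abs_of_nonpos hi, abs_of_nonneg hi']
    rw [show d i + d i' = -((-d i) - d i') by ring, abs_neg]
  · rcases eq_or_lt_of_le hi with h0 | h0
    · rw [h0]; simp
    · have : d i' = 0 := le_antisymm hi' (by nlinarith)
      rw [this]; simp

/-- The side condition of (42) cannot be read at stage `j` (as the HAL text prints it,
"`{i_j, i'_j} ⊆ E^{(j)}` or `{i_j, i'_j} ⊆ F^{(j)}`"): on two indices with `d = (−1, 3)` (so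
`i_j = 0 ∈ F^{(j−1)}`, `i'_j = 1 ∈ E^{(j−1)}`), after the move `d = (2, 3)`, both indices lie in
`E^{(j)}`, but `ε_0^{(j)} = 2 ≠ 1 + 3` (law (43) is the right one there). Whether this sign pattern
is actually reached by the Perron sequence of Lemma 8.2 was not checked and is moot: the proof
uses (41)–(43) only through `δ^{(j)} = δ^{(j−1)}` (`delta_move` below), which holds for every
move. [cite: CossartPiltant2008, Prop 8.3 (42), p. 25 l. 144] -/
theorem eps_move_printed_condition_counterexample :
    let d : Fin 2 → ℤ := ![-1, 3]
    0 < move 0 1 d 0 ∧ 0 < move 0 1 d 1 ∧ eps (move 0 1 d) 0 ≠ eps d 0 + eps d 1 := by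
  simp [move, eps, Function.update]

/-! ### `δ` and its invariance (HAL p. 26 l. 5: "`δ^{(j)} = δ^{(j−1)}` follows from (41) and from (42) or (43)") -/

/-- `δ := gcd({ε_k}_{k ∈ E ∪ F})`, the gcd of `|d_k|` over the support of `d`, literally as in
the text (normalised, i.e. nonnegative, `Finset.gcd` over `ℤ`).
[cite: CossartPiltant2008, Prop 8.3, p. 25 l. 116] -/
def delta [Fintype ι] (d : ι → ℤ) : ℤ :=
  (univ.filter fun k => d k ≠ 0).gcd (eps d)

section gcd

variable [Fintype ι]

omit [DecidableEq ι] [Fintype ι] in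
/-- Two `Finset.gcd`s over `ℤ` that divide each other are equal (both are normalised).
[folklore] -/
theorem gcd_eq_of_dvd_dvd {s t : Finset ι} {f g : ι → ℤ}
    (h₁ : s.gcd f ∣ t.gcd g) (h₂ : t.gcd g ∣ s.gcd f) : s.gcd f = t.gcd g := by
  rw [← Finset.normalize_gcd (s := s) (f := f), ← Finset.normalize_gcd (s := t) (f := g)]
  exact normalize_eq_normalize h₁ h₂

omit [DecidableEq ι] in
/-- `δ` equals the gcd of ALL coordinates of `d` (zeros and signs do not matter). [folklore] -/
theorem delta_eq_gcd (d : ι → ℤ) : delta d = univ.gcd d := by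
  unfold delta
  have h1 : (univ.filter fun k => d k ≠ 0).gcd (eps d) = univ.gcd (eps d) := by
    rw [Finset.gcd_eq_gcd_filter_ne_zero (s := univ) (f := eps d)]
    congr 1
    ext k
    simp [eps]
  rw [h1]
  apply gcd_eq_of_dvd_dvd
  · exact Finset.dvd_gcd fun k _ => (Finset.gcd_dvd (mem_univ k)).trans (abs_dvd_self (d k))
  · exact Finset.dvd_gcd fun k _ => (Finset.gcd_dvd (mem_univ k)).trans (self_dvd_abs (d k))

/-- The gcd of the coordinates is invariant under a Perron move with `i ≠ i'`. [folklore] -/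
theorem gcd_move {i i' : ι} (d : ι → ℤ) (h : i ≠ i') :
    univ.gcd (move i i' d) = univ.gcd d := by
  apply gcd_eq_of_dvd_dvd
  · apply Finset.dvd_gcd
    intro k _
    by_cases hk : k = i
    · subst hk
      have h1 : univ.gcd (move k i' d) ∣ move k i' d k := Finset.gcd_dvd (mem_univ k)
      have h2 : univ.gcd (move k i' d) ∣ move k i' d i' := Finset.gcd_dvd (mem_univ i')
      rw [move_apply_self] at h1
      rw [move_apply_snd d h] at h2
      have : d k = (d k + d i') - d i' := by ring
      rw [this]
      exact dvd_sub h1 h2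
    · rw [← move_apply_of_ne (i' := i') d hk]
      exact Finset.gcd_dvd (mem_univ k)
  · apply Finset.dvd_gcd
    intro k _
    by_cases hk : k = i
    · subst hk
      rw [move_apply_self]
      exact dvd_add (Finset.gcd_dvd (mem_univ k)) (Finset.gcd_dvd (mem_univ i'))
    · rw [move_apply_of_ne d hk]
      exact Finset.gcd_dvd (mem_univ k)

/-- **`δ^{(j)} = δ^{(j−1)}`** (HAL p. 26 l. 5), for every move with `i_j ≠ i'_j`, in all sign
cases at once. [cite: CossartPiltant2008, Prop 8.3, p. 26 l. 5] -/
theorem delta_move {i i' : ι} (d : ι → ℤ) (h : i ≠ i') : delta (move i i' d) = delta d := by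
  rw [delta_eq_gcd, delta_eq_gcd, gcd_move d h]

/-- A Perron sequence (37): the list of pairs `(i_j, i'_j)`, `1 ≤ j ≤ n − 1`, applied in order.
[cite: CossartPiltant2008, Lemma 8.2 / (37)] -/
def moves : List (ι × ι) → (ι → ℤ) → (ι → ℤ)
  | [], d => d
  | p :: ps, d => moves ps (move p.1 p.2 d)

/-- `δ^{(n−1)} = δ^{(0)}` along any Perron sequence. [cite: CossartPiltant2008, Prop 8.3, p. 26 l. 5–6] -/
theorem delta_moves (ps : List (ι × ι)) (hps : ∀ p ∈ ps, p.1 ≠ p.2) (d : ι → ℤ) :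
    delta (moves ps d) = delta d := by
  induction ps generalizing d with
  | nil => rfl
  | cons p ps ih =>
    simp only [moves]
    rw [ih (fun q hq => hps q (List.mem_cons_of_mem _ hq)), delta_move d (hps p (by simp))]

/-- Matrix form of the invariance: for `A ∈ GL(ι, ℤ)` (the matrix of (37)),
`gcd (d ᵥ* A) = gcd d`; with `d^{(n−1)} = d^{(0)} ᵥ* A` this is `δ^{(n−1)} = δ^{(0)}` again.
[folklore] -/
theorem gcd_vecMul_of_isUnit_det (d : ι → ℤ) (A : Matrix ι ι ℤ) (hA : IsUnit A.det) :
    univ.gcd (Matrix.vecMul d A) = univ.gcd d := by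
  have key : ∀ (v : ι → ℤ) (M : Matrix ι ι ℤ), univ.gcd v ∣ univ.gcd (Matrix.vecMul v M) := by
    intro v M
    apply Finset.dvd_gcd
    intro k _
    rw [Matrix.vecMul, dotProduct]
    exact Finset.dvd_sum fun j _ => dvd_mul_of_dvd_left (Finset.gcd_dvd (mem_univ j)) _
  apply gcd_eq_of_dvd_dvd
  · have h := key (Matrix.vecMul d A) A⁻¹
    rwa [Matrix.vecMul_vecMul, Matrix.mul_nonsing_inv _ hA, Matrix.vecMul_one] at h
  · exact key d A

end gcd

/-! ### `δ^{(0)} = 1` from assumption (2) -/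

omit [DecidableEq ι] in
/-- For the initial difference vector `d^{(0)}` (with `d^{(0)}_{i₀} = l`, `l` prime — the exponent
of `x_0` in `x_0^l` — and the other coordinates `−α_i`): `gcd = 1` iff NOT all coordinates are
divisible by `l`. [folklore] -/
theorem gcd_eq_one_iff_of_prime [Fintype ι] {l : ℕ} (hl : l.Prime) (d : ι → ℤ) {i₀ : ι}
    (h0 : d i₀ = l) : univ.gcd d = 1 ↔ ¬ ∀ k, (l : ℤ) ∣ d k := by
  constructor
  · intro hg hall
    have : (l : ℤ) ∣ univ.gcd d := Finset.dvd_gcd fun k _ => hall k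
    rw [hg] at this
    have h1 : (l : ℤ).natAbs ∣ 1 := by
      have := Int.natAbs_dvd_natAbs.mpr this
      simpa using this
    simp only [Int.natAbs_natCast, Nat.dvd_one] at h1
    exact hl.one_lt.ne' h1
  · intro hnot
    have hdiv : univ.gcd d ∣ (l : ℤ) := h0 ▸ Finset.gcd_dvd (mem_univ i₀)
    have hnn : 0 ≤ univ.gcd d :=
      Int.nonneg_of_normalize_eq_self (Finset.normalize_gcd (s := univ) (f := d))
    have hnat : (univ.gcd d).natAbs ∣ l := by
      have := Int.natAbs_dvd_natAbs.mpr hdiv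
      simpa using this
    rcases (Nat.dvd_prime hl).mp hnat with h1 | h2
    · have : univ.gcd d = ((univ.gcd d).natAbs : ℤ) := (Int.natAbs_of_nonneg hnn).symm
      rw [this, h1]; simp
    · exfalso
      apply hnot
      intro k
      have hk : univ.gcd d ∣ d k := Finset.gcd_dvd (mem_univ k)
      have : univ.gcd d = (l : ℤ) := by
        rw [← Int.natAbs_of_nonneg hnn, h2]
      rwa [this] at hk

/-- The initial vector of the text: `d^{(0)} = exp(x_0^l) − exp(f_l) = l e_0 − Σ α_i e_i` on the
index set `Option κ` (`none` = the index `0` of `x_0`, `some i` = the index of `x_i`, `1 ≤ i ≤ r`).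
[cite: CossartPiltant2008, Prop 8.3 (36)] -/
def dInit {κ : Type*} (l : ℕ) (α : κ → ℕ) : Option κ → ℤ
  | none => l
  | some i => -(α i : ℤ)

/-- **`δ^{(0)} = 1 ↔ ¬ ∀ i, l ∣ α_i`** for `l` prime. [cite: CossartPiltant2008, Prop 8.3, p. 25 l. 117] -/
theorem delta_init_eq_one_iff {κ : Type*} [Fintype κ] [DecidableEq κ] {l : ℕ} (hl : l.Prime)
    (α : κ → ℕ) : delta (dInit l α) = 1 ↔ ¬ ∀ i, l ∣ α i := by
  rw [delta_eq_gcd, gcd_eq_one_iff_of_prime hl (dInit l α) (i₀ := none) rfl]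
  simp only [not_iff_not]
  constructor
  · intro h i
    have := h (some i)
    simp only [dInit, dvd_neg] at this
    exact_mod_cast this
  · intro h k
    cases k with
    | none => simp [dInit]
    | some i => simp only [dInit, dvd_neg]; exact_mod_cast h i

/-- Assumption (2) ⇒ `¬ ∀ i, l ∣ α_i`: in a torsion-free value group `Γ` (every totally ordered
abelian group is), if `l · w = Σ α_i · v_i` with all `v_i ∈ Γ_V`, `l ≠ 0`, and all `α_i`
divisible by `l`, then `w ∈ Γ_V` — contradicting "`Wη` has order `l` in `Γ_W / Γ_V`" (35).
Here `w = W η = (1/l) W f_l`, `v_i = W x_i = V x_i` by (35)–(36). [cite: CossartPiltant2008, Prop 8.3 (35)–(36)] -/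
theorem not_forall_dvd_of_not_mem {κ : Type*} [Fintype κ] {Γ : Type*} [AddCommGroup Γ]
    [IsAddTorsionFree Γ] (ΓV : AddSubgroup Γ) (v : κ → Γ) (hv : ∀ i, v i ∈ ΓV) (w : Γ)
    (hw : w ∉ ΓV) {l : ℕ} (hl : l ≠ 0) (α : κ → ℕ) (h : (l : ℤ) • w = ∑ i, (α i : ℤ) • v i) :
    ¬ ∀ i, l ∣ α i := by
  intro hall
  choose β hβ using hall
  apply hw
  have : (l : ℤ) • w = (l : ℤ) • ∑ i, (β i : ℤ) • v i := by
    rw [h, Finset.smul_sum]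
    refine Finset.sum_congr rfl fun i _ => ?_
    rw [hβ i, smul_smul]
    push_cast
    rfl
  have hlz : (l : ℤ) ≠ 0 := by exact_mod_cast hl
  have hw' : w = ∑ i, (β i : ℤ) • v i := (smul_right_injective Γ hlz) this
  rw [hw']
  exact ΓV.sum_mem fun i _ => ΓV.zsmul_mem (hv i) _

/-! ### (38)–(39) from rational independence -/

/-- (38)–(39): if `Σ_j d_j · w_j = 0` in an abelian group, `w_i = w_{i'}` with `i ≠ i'`, and the
family `{w_j}_{j ≠ i'}` is `ℤ`-linearly independent ("rationally independent values"), then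
`d_j = 0` for `j ∉ {i, i'}` (38) and `d_i + d_{i'} = 0` (39). In the text `d = l a_0 − Σ α_k a_k`
(rows of `A`), `w_j = W x_j^{(n−1)}`, and `Σ_j d_j w_j = l Wη − W f_l = 0` is (35).
[cite: CossartPiltant2008, Prop 8.3 (38)–(39)] -/
theorem coeff_eq_of_linearIndependent [Fintype ι] {Γ : Type*} [AddCommGroup Γ] (w : ι → Γ)
    {i i' : ι} (hne : i ≠ i') (hw : w i = w i')
    (hli : LinearIndependent ℤ fun j : {j : ι // j ≠ i'} => w j) (d : ι → ℤ)
    (hd : ∑ j, d j • w j = 0) :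
    (∀ j, j ≠ i → j ≠ i' → d j = 0) ∧ d i + d i' = 0 := by
  classical
  -- fold the `i'`-term into the `i`-term
  let g : {j : ι // j ≠ i'} → ℤ := fun j => d j + if (j : ι) = i then d i' else 0
  have hsum : ∑ j : {j : ι // j ≠ i'}, g j • w j = 0 := by
    have hmem : i ∈ univ.erase i' := by simp [hne]
    have step1 : ∑ j : {j : ι // j ≠ i'}, g j • w j
        = ∑ j ∈ univ.erase i', (d j + if j = i then d i' else 0) • w j := by
      rw [← Finset.sum_subtype (univ.erase i') (p := fun j => j ≠ i') (by simp)
        (f := fun j => (d j + if j = i then d i' else 0) • w j)]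
    rw [step1]
    simp only [add_smul, Finset.sum_add_distrib, ite_smul, zero_smul]
    rw [Finset.sum_ite_eq' (univ.erase i') i (fun j => d i' • w j), if_pos hmem, hw,
      Finset.sum_erase_add _ _ (mem_univ i'), hd]
  have hg : ∀ j, g j = 0 := Fintype.linearIndependent_iff.mp hli g hsum
  refine ⟨fun j hj hj' => ?_, ?_⟩
  · have := hg ⟨j, hj'⟩
    simpa [g, hj] using this
  · have := hg ⟨i, hne⟩
    simpa [g] using this

/-! ### (40): the last stage, `m`, and `m = 1` -/

omit [DecidableEq ι] in
/-- At the last stage `E` and `F` are contained in `{i_n, i'_n}`, `m := (l a_{0 i_n} − β_{i_n}) +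
(l a_{0 i'_n} − β_{i'_n}) = d⁺_{i_n} + d⁺_{i'_n}` (since `l a_{0k} − β_k = max(d_k, 0)`), and (39)
forces `m = |d_{i_n}|` (one of the two positive parts vanishes).
[cite: CossartPiltant2008, Prop 8.3 (40)] -/
theorem m_eq_abs {i i' : ι} (d : ι → ℤ) (h39 : d i + d i' = 0) :
    max (d i) 0 + max (d i') 0 = |d i| := by
  have : d i' = -d i := by linarith
  rw [this]
  rcases le_total 0 (d i) with h | h
  · rw [max_eq_left h, max_eq_right (by linarith), abs_of_nonneg h]; ring
  · rw [max_eq_right h, max_eq_left (by linarith), abs_of_nonpos h]; ring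

/-- `l a_{0k} − β_k = max(d_k, 0)` where `β_k = min(l a_{0k}, Σ α a_k)` and
`d_k = l a_{0k} − Σ_i α_i a_{ik}`. [folklore] -/
theorem sub_min_eq_max_sub (x b : ℤ) : x - min x b = max (x - b) 0 := by
  rcases le_total x b with h | h
  · rw [min_eq_left h, max_eq_right (by linarith)]; ring
  · rw [min_eq_right h, max_eq_left (by linarith)]

/-- "Note that `m > 0` since `A` is a nonsingular matrix": `d^{(n−1)} = d^{(0)} ᵥ* A ≠ 0` because
`d^{(0)} ≠ 0` (`d^{(0)}_0 = l`) and `det A ≠ 0`. [cite: CossartPiltant2008, Prop 8.3, p. 25 l. 76] -/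
theorem vecMul_ne_zero_of_det_ne_zero [Fintype ι] (d : ι → ℤ) (hd : d ≠ 0) (A : Matrix ι ι ℤ)
    (hA : A.det ≠ 0) : Matrix.vecMul d A ≠ 0 :=
  fun h => hd (Matrix.eq_zero_of_vecMul_eq_zero hA h)

/-- … hence, with (38) (`d` vanishes off `{i_n, i'_n}`) and (39), `m = |d_{i_n}| > 0`.
[cite: CossartPiltant2008, Prop 8.3, p. 25 l. 76] -/
theorem m_pos_of_ne_zero {i i' : ι} (d : ι → ℤ) (hd : d ≠ 0)
    (h38 : ∀ j, j ≠ i → j ≠ i' → d j = 0) (h39 : d i + d i' = 0) : 0 < |d i| := by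
  rw [abs_pos]
  intro hi
  apply hd
  funext j
  by_cases hj : j = i
  · subst hj; simpa using hi
  by_cases hj' : j = i'
  · subst hj'; simp; linarith
  · exact h38 j hj hj'

/-- At the last stage `δ^{(n−1)} = gcd(m, m) = m`: the gcd of a vector supported on `{i, i'}` with
`d_i + d_{i'} = 0` is `|d_i|`. [cite: CossartPiltant2008, Prop 8.3, p. 26 l. 5–6] -/
theorem delta_eq_abs_of_pair [Fintype ι] {i i' : ι} (d : ι → ℤ)
    (h38 : ∀ j, j ≠ i → j ≠ i' → d j = 0) (h39 : d i + d i' = 0) : delta d = |d i| := by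
  rw [delta_eq_gcd]
  have hi' : d i' = -d i := by linarith
  rw [Int.abs_eq_normalize, ← Finset.normalize_gcd (s := univ) (f := d)]
  apply normalize_eq_normalize
  · exact Finset.gcd_dvd (mem_univ i)
  · apply Finset.dvd_gcd
    intro j _
    by_cases hj : j = i
    · subst hj; exact dvd_rfl
    by_cases hj' : j = i'
    · subst hj'; rw [hi']; exact dvd_neg.mpr dvd_rfl
    · rw [h38 j hj hj']; exact dvd_zero _

/-- **The claim `m = 1`** (HAL p. 25 l. 78, p. 26 l. 5–6), assembled: along any Perron sequence
of moves with distinct indices starting from `d^{(0)}` with `δ^{(0)} = 1`, if the final vector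
satisfies (38)–(39) at the pair `(i_n, i'_n)`, then `m = |d^{(n−1)}_{i_n}| = 1`.
[cite: CossartPiltant2008, Prop 8.3, p. 26 l. 5–6] -/
theorem m_eq_one [Fintype ι] (ps : List (ι × ι)) (hps : ∀ p ∈ ps, p.1 ≠ p.2) (d₀ : ι → ℤ)
    (hδ₀ : delta d₀ = 1) {i i' : ι}
    (h38 : ∀ j, j ≠ i → j ≠ i' → moves ps d₀ j = 0)
    (h39 : moves ps d₀ i + moves ps d₀ i' = 0) :
    max (moves ps d₀ i) 0 + max (moves ps d₀ i') 0 = 1 := by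
  rw [m_eq_abs _ h39, ← delta_eq_abs_of_pair _ h38 h39, delta_moves ps hps, hδ₀]

/-- Matrix version of `m = 1`: if `d = d^{(0)} ᵥ* A` with `A ∈ GL(ι, ℤ)`, `gcd d^{(0)} = 1`, and `d`
satisfies (38)–(39) at `(i, i')`, then `|d_i| = 1`. [cite: CossartPiltant2008, Prop 8.3, p. 26 l. 5–6] -/
theorem m_eq_one_matrix [Fintype ι] (d₀ : ι → ℤ) (A : Matrix ι ι ℤ) (hA : IsUnit A.det)
    (hδ₀ : delta d₀ = 1) {i i' : ι}
    (h38 : ∀ j, j ≠ i → j ≠ i' → Matrix.vecMul d₀ A j = 0)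
    (h39 : Matrix.vecMul d₀ A i + Matrix.vecMul d₀ A i' = 0) :
    |Matrix.vecMul d₀ A i| = 1 := by
  rw [← delta_eq_abs_of_pair _ h38 h39, delta_eq_gcd, gcd_vecMul_of_isUnit_det d₀ A hA,
    ← delta_eq_gcd, hδ₀]

/-! ### The middle terms of `P(x_0)` in (40) -/

omit [DecidableEq ι] in
/-- Divisibility of the middle terms by `g`: if `i · B ≤ l · φ` componentwise (`0 ≤ i ≤ l`,
`0 < l`; from `f_i^{l!/i} ∈ I R = (f_l^{l!/l})`, (36)) and `X = l · a₀` (`X = exp(x_0^l)`), then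
`min(X, B) ≤ φ + (l − i) · a₀ = exp(f_i x_0^{l−i})` componentwise, i.e. `g = x^{min(X,B)}`
divides `f_i x_0^{l−i}` — "we get from (36) and (38) that
`g := gcd(x_0^l, {f_i x_0^{l−i}}_{1 ≤ i ≤ l}) = Π_j x_j^{β_j}`", p. 25 l. 48–57.
[cite: CossartPiltant2008, Prop 8.3, p. 25 l. 48–57] -/
theorem min_le_middle {l i : ℕ} (hl : 0 < l) (hil : i ≤ l) (φ B a₀ : ι → ℤ)
    (H : ∀ k, (i : ℤ) * B k ≤ (l : ℤ) * φ k) (k : ι) :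
    min ((l : ℤ) * a₀ k) (B k) ≤ φ k + ((l : ℤ) - i) * a₀ k := by
  have hl' : (0 : ℤ) < l := by exact_mod_cast hl
  have hil' : (i : ℤ) ≤ l := by exact_mod_cast hil
  have hi0 : (0 : ℤ) ≤ i := by exact_mod_cast Nat.zero_le i
  -- `l · min ≤ i · B + (l − i) · X ≤ l · (φ + (l − i) a₀)`
  have h1 : (l : ℤ) * min ((l : ℤ) * a₀ k) (B k) ≤ (i : ℤ) * B k + ((l : ℤ) - i) * ((l : ℤ) * a₀ k) := by
    have hm1 : min ((l : ℤ) * a₀ k) (B k) ≤ B k := min_le_right _ _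
    have hm2 : min ((l : ℤ) * a₀ k) (B k) ≤ (l : ℤ) * a₀ k := min_le_left _ _
    nlinarith
  have h2 : (i : ℤ) * B k + ((l : ℤ) - i) * ((l : ℤ) * a₀ k) ≤ (l : ℤ) * (φ k + ((l : ℤ) - i) * a₀ k) := by
    nlinarith [H k]
  exact le_of_mul_le_mul_left (h1.trans h2) hl'

omit [DecidableEq ι] in
/-- Strict order inequality for the middle terms ("`+` terms of order at least `m + 1`" in (40)):
if `C ≤ D` componentwise and the pairings against some weight vector differ, then `Σ C < Σ D`.
In the text `D = l · exp(f_i x_0^{l−i})`, `C = i · B + (l − i) · X` (so `Σ C = l · ord f_l` by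
(38)–(39)), the weights are `w_k = W x_k^{(n−1)} > 0` and the pairings differ by the STRICT
inequality (35): "and from (36) and (39) that `ord x_0^l = ord f_l < min_{1≤i≤l−1} ord f_i x_0^{l−i}`",
p. 25 l. 59–61. [cite: CossartPiltant2008, Prop 8.3 (35), p. 25 l. 59–61] -/
theorem sum_lt_sum_of_pairing_ne [Fintype ι] {R : Type*} [CommRing R] [LinearOrder R]
    [IsStrictOrderedRing R] (C D : ι → ℤ) (w : ι → R) (hle : ∀ k, C k ≤ D k)
    (hw : ∑ k, (C k : R) * w k ≠ ∑ k, (D k : R) * w k) : ∑ k, C k < ∑ k, D k := by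
  have hne : C ≠ D := by
    rintro rfl
    exact hw rfl
  obtain ⟨k, hk⟩ : ∃ k, C k ≠ D k := Function.ne_iff.mp hne
  exact Finset.sum_lt_sum (fun j _ => hle j) ⟨k, mem_univ k, lt_of_le_of_ne (hle k) hk⟩

omit [DecidableEq ι] in
/-- The supports `E = {d > 0}` and `F = {d < 0}` are disjoint ("Note that `E^{(j)} ∩ F^{(j)} = ∅`",
p. 25 l. 108) and `ε = d⁺ + d⁻ = |d|`. [cite: CossartPiltant2008, Prop 8.3, p. 25 l. 108] -/
theorem support_disjoint [Fintype ι] (d : ι → ℤ) :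
    Disjoint (univ.filter fun k => 0 < d k) (univ.filter fun k => d k < 0) := by
  rw [Finset.disjoint_filter]
  intro k _ hk
  exact not_lt.mpr hk.le

omit [DecidableEq ι] in
/-- `ε_k = max(d_k,0) + max(−d_k,0)`. [folklore] -/
theorem eps_eq_posPart_add_negPart (d : ι → ℤ) (k : ι) :
    eps d k = max (d k) 0 + max (-d k) 0 := by
  simp only [eps]
  rcases le_total 0 (d k) with h | h
  · rw [abs_of_nonneg h, max_eq_left h, max_eq_right (by linarith)]; ring
  · rw [abs_of_nonpos h, max_eq_right h, max_eq_left (by linarith)]; ring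

/-! ### A worked instance (`l = p = 2`, `r = 1`) -/

/-- Instance of the whole bookkeeping: `l = p = 2`, `r = 1`, `f_2 = u · x_1^3` (`α_1 = 3` is odd,
which is assumption (2)), values `(W x_0, W x_1) = (3/2, 1)`. Then `d^{(0)} = (2, −3)`,
`δ^{(0)} = 1`; the Perron algorithm of Lemma 8.2 blows up `(x_1, x_0)` (`i_1 = 1`, `i'_1 = 0`,
values become `(1/2, 1)`) and then `(x_0, x_1)` (`i_2 = 0`, `i'_2 = 1`, values `(1/2, 1/2)`,
equal: this is stage `n − 1`); the difference vectors are `(2, −3) → (2, −1) → (1, −1)`, of the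
shape (38)–(39) with `m = 1`, and `δ = 1` throughout (kernel evaluation). [folklore] -/
theorem instance_l2 :
    moves [((1 : Fin 2), 0), (0, 1)] ![2, -3] = ![1, -1] ∧
      delta (![2, -3] : Fin 2 → ℤ) = 1 ∧ delta (![2, -1] : Fin 2 → ℤ) = 1 ∧
      delta (![1, -1] : Fin 2 → ℤ) = 1 := by
  refine ⟨?_, by decide, by decide, by decide⟩
  decide

end PrimeAscent83

end Literature.AlgebraicGeometry.CossartPiltant200819.CP2008
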